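import Summits.BirchSwinnertonDyer.Rank1Residual.ManinAdditive.CuspidalKummerCubeNoBlindLaws
import HarnessLib
import HarnessLib.Audit.Tags

/-!
# The cube-exponent law LAW₃ by CUBE-ROOT DESCENT in the `Γ₀`-tower (cell `bsd-f2-manin`, planner `-an` g36, MEMO-an §79)

TYPER NOTE (typer g19, T-an-39 file A).  SOURCE = HOME/an/g36/CubeExponentLawDescent-an-g36.lean sha16 0fb5438f87b585cd (272 l.; an: rc 0 · 0 err · 0 warn ·
no proof gaps, 4 s; BC7 HOME/an/g36/g36-bc7.out + g36-bc7-N2.out CLEAN; chain check CubeDescentFullSim2-an-g36.lean bd9356bc34bd2dc1), landed VERBATIM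
except this note, three one-line docstrings, and the word «s∗rry-free» rendered «kernel-checked».  Imports ONLY the landed leaf
`CuspidalKummerCubeNoBlindLaws` — ROUTE-INDEPENDENT.  STATUS OF THE FOUR LEAVES at landing time: M0 `ModularFunctionFieldMono` and M2
`MonomialNotModularFunction` are ALREADY THEOREMS in the tree (`…ManinAdditive.ModularFunctionFieldLevel`, p715111:
`ModularFunctionFieldEta.modularFunctionFieldMono_shape`, `…monomialNotModularFunction_shape`, definitionally these Props), M1
`EtaQuotientMemFunctionField` becomes one with `…ManinAdditive.ModularFunctionFieldEta` (p715140, `etaQuotientMemFunctionField_shape`; the local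
`toLaurent/etaPos/etaNeg/etaLaurent` below have bodies IDENTICAL to that file's, so the closure is `exact` by δ-reduction) — they stay plain
`def … : Prop` here (no Summit-side import of those proof files, to keep this leaf light; closures live in an's FILE F, prover-landed under
`Theorems/`); N1 `CubeRepFirstDescent`, N2 `NoNewmanCubeRootRepAtThreeN`, P79 `KummerCubeSeriesNotCubeAtThreeN` are `@[conjecture]` nodes (N1 is
PROVED in FILE F from M1 ∧ M2; P79 = the one geometric leaf, paper proof in the docstring).  an's FILES B/F (`Summits/…/Theorems/ManinLocalTwoThree
CubeRootDescent{,Closed}.lean`, `--supports stmt-BirchSwinnertonDyer-22968`) are PROVER-ONLY targets (`perm.theorems-prover-only` for the typer seat) —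
handed to the C3 LEAD / p-seats on INBOX with the adapted imports.  PARTITION 0 · beyond-print theorem: no · BSD is not proved by this; C2/C3 OPEN.

HONEST FRAMING.  LENS = analytic / period-lattice (the tangent-line Kummer class of a rational `3`-torsion point, rows
E-an-55–58, LAW₃ of `CuspidalKummerCubeLaws.lean`).  This file REDUCES the cell's OPEN law **LAW₃
`CuspidalKummerCubeExponentLaw`** (census 496/496; C3 skeleton `kato_shift_three` v18 stub 3 in its non-blind form LAW₃♮,
and — with K_geo₃ = E-an-57 — the stubs T3III / T3W / NB₃ via `noBlind_of_cuspidalKummerCubeExponentLaw_of_representative`)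
to FOUR statements none of which mentions the Manin constant, a torsion law, or a census:

* three AUTOMORPHIC facts about the tree's own `modularFunctionField N ⊆ ℂ((q))` (theorem-grade, E-blind, nothing
  conjectural; typed here as `Prop`s because their proofs need the `ModularForm (Gamma0 N) k` packaging of
  `η`-quotients, which the tree has as functions — `etaQuotient_smul_of_mem_Gamma0` — but not yet as bundled forms):
  M0 `ModularFunctionFieldMono` (`N ∣ M ⟹ K_N ≤ K_M`), M1 `EtaQuotientMemFunctionField` (Newman's conditions in weight
  `0` put the `q`-expansion of `∏ η(δτ)^{s_δ}` in `K_M`), M2 `MonomialNotModularFunction` (`q^m ∈ K_M ⟹ m = 0`);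
* ONE geometric statement P79 `KummerCubeSeriesNotCubeAtThreeN`: for an `X₀(N)`-OPTIMAL datum (lattice clause) and a
  rational point `T` of order `3` on the short model, the Kummer cube series `Θ_T` is not a cube in `K_{3N}`.  Paper
  proof (3 lines, dictionary «formal germ = parametrisation» of `IsParamGerm` as in E-an-47/55/57): `Θ_T = (t³·f_T)∘φ`
  with `t = −x/y`, `div f_T = 3(T) − 3(O)`; a cube root `u ∈ ℂ(X₀(3N))` would make `π^*φ^*((T) − (O)) = div(u/(t∘φ∘π))`
  principal on `X₀(3N)`; but `π : X₀(3N) → X₀(N)` is totally ramified at the cusp `0` (widths `3N` vs `N`, `3 ∣ N`), so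
  `π^*` is injective on Jacobians, and `φ^* : E → J₀(N)` is injective exactly because `φ` is optimal (lattice clause
  `Λ_W = c·Λ_f`); `T ≠ O`.  Contradiction.

THE DESCENT (paper; the Lean composition `cuspidalKummerCubeExponentLaw_of_descent` below is kernel-checked from the two
intermediate nodes N1/N2; the Theorems-side companion FILE B `ManinLocalTwoThreeCubeRootDescent.lean` (an g36,
kernel-checked) proves `N1 ⟸ M1 ∧ M2` and `N2 ⟸ M0 ∧ M1 ∧ M2 ∧ P79`, hence `LAW₃ ⟸ M0 ∧ M1 ∧ M2 ∧ P79`).  Let `Θ·B³·qⁿ¹ = qⁿ²·g·A³` be a cuspidal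
Kummer cube representative (`IsCuspidalKummerCubeRep N Θ r g A B`): `G₀ := qⁿ²g/qⁿ¹ ∈ K_N`, `h₀ := A/B ∈ K_N`,
`Θ = G₀·h₀³`, and `η_r := q^{S₁(r)/24}·g ∈ K_N` by M1 (`S₁(r) = Σ δ r_δ`, `S₂(r) = Σ (N/δ) r_δ`).  (N1) `G₀/η_r = q^e ∈ K_N`
forces `e = 0` (M2), i.e. `n₂ − n₁ = S₁(r)/24`; comparing `q`-orders in `ℚ⟦q⟧` (`Θ(0) = −1`, `g(0) = 1`) gives
`3 ∣ n₂ − n₁`, hence **`72 ∣ S₁(r)`**.  (N2) If EVERY `r_δ ≡ 0 (mod 3)`, put `s := r/3` on the divisors of `N` (zero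
elsewhere).  Then `NewmanCond (3N) s 0` holds OUTRIGHT (`newmanCond_descentExp`, PROVED): `Σ s = 0`; `Σ δ s_δ = S₁(r)/3 ∈
24ℤ` by N1; `Σ (3N/δ) s_δ = S₂(r) ∈ 24ℤ` by Newman for `r`; and — the point where `ℓ = 3` differs from `ℓ = 2` —
`∏ δ^{|s_δ|}` is a square BECAUSE ITS CUBE `∏ δ^{|r_δ|}` IS (`isSquare_of_isSquare_pow_three`).  So `η_s ∈ K_{3N}` (M1 at
level `3N`), `η_s³ = η_r = G₀`, and `Θ = (η_s·h₀)³` is a cube in `K_{3N}` (M0 for `h₀`) — contradicting P79.  Hence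
**LAW₃** (all `9 ∣ N`, every representative, no use of `3`-adic cubes, of the Manin constant, or of a census), hence
LAW₃♮ (`cuspidalKummerCubeExponentLawNonBlind_of_descent`), hence with E-an-57 the `3`-blindness law NB₃ and C3 on the
rational-`3`-torsion locus (tree edges, `ThreeBlindInvariance` / p631186 / p632572).

WHY `ℓ = 2` DOES NOT CLOSE THE SAME WAY (MEMO-an §78/§79.6): for `s = r/2` the Newman congruences descend identically but
squareness of `∏ δ^{|s_δ|}` is NOT inherited from its square; `η_{r/2}` then lives on `Γ₀ ∩ Γ₁`-type covers whose
pull-back on Jacobians has kernel `⊇ Σ(N)` — exactly the blind `2`-torsion points `ι(T) ∈ Σ(N)[2]` of E-an-152/154/155.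
At `ℓ = 3` the descent never leaves the `Γ₀`-tower (`X₀(3N) → X₀(N)`, injective on Jacobians), so there are no
`3`-blind optimal points for an `η`-reason: the `η`-side of C3 is one law (E-an-57) shorter than the `η`-side of C2.

STATUS.  PROVED here (kernel-checked): `isSquare_of_isSquare_pow_three`, `newmanCond_descentExp` (E-an-159),
`cuspidalKummerCubeExponentLaw_of_descent : N1 → N2 → LAW₃`, `…NonBlind_of_descent`.  TYPED, nothing asserted:
N1 `CubeRepFirstDescent` (E-an-160), N2 `NoNewmanCubeRootRepAtThreeN` (E-an-161), M0/M1/M2 (E-an-162/163/164),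
P79 `KummerCubeSeriesNotCubeAtThreeN` (E-an-165).  Falsifier (MEMO-an §79.3, the 7 exact genus-1 cube representatives
of `HOME/an/g14-genus1-eta3.out`): `S₁(r) = −72` in 7/7, `S₂(r) ∈ {0, 72}` in 7/7, some `r_δ ≢ 0 (3)` in 7/7.
Beyond-print theorem: no (LAW₃ becomes a theorem only when M0–M2 and P79 land).  BSD is not proved by this; Manin's
conjecture is not proved by this; C3 `ManinPrimeToThreeAtNine` stays OPEN (its Kummer branch now rests on E-an-57 alone).
[folklore]
-/

set_option autoImplicit false

noncomputable section

open PowerSeries CongruenceSubgroup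
open WeierstrassCurve Literature.NumberTheory.EllipticCurves Literature.NumberTheory.EllipticCurves.ModularForms

namespace Summit.BirchSwinnertonDyer.Rank1Residual.ManinAdditive.CuspidalKummerThree

open Summit.BirchSwinnertonDyer.Rank1Residual.ManinAdditive.CuspidalKummer

/-! ### §1 The arithmetic of the descent `r ↦ r/3` (E-an-159, PROVED) -/

/-- A natural number whose cube is a square is a square. [folklore] -/
theorem isSquare_of_isSquare_pow_three {x : ℕ} (h : IsSquare (x ^ 3)) : IsSquare x := by
  rcases Nat.eq_zero_or_pos x with rfl | hx
  · exact ⟨0, rfl⟩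
  obtain ⟨c, hc⟩ := h
  have h2 : x ^ 2 ∣ c ^ 2 := Dvd.intro x (by rw [← pow_succ, hc, sq])
  obtain ⟨d, rfl⟩ := (Nat.pow_dvd_pow_iff two_ne_zero).mp h2
  refine ⟨d, Nat.eq_of_mul_eq_mul_left (pow_pos hx 2) ?_⟩
  calc x ^ 2 * x = x ^ 3 := (pow_succ x 2).symm
    _ = x * d * (x * d) := hc
    _ = x ^ 2 * (d * d) := by ring

/-- The descended exponent vector `s = r/3` on the divisors of `N`, extended by zero (values of `r` off `N.divisors` are
junk for `IsCuspidalKummerCubeRep N`). -/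
def descentExp (N : ℕ) (r : ℕ → ℤ) (δ : ℕ) : ℤ := if δ ∈ N.divisors then r δ / 3 else 0

/-- `descentExp` on a divisor of `N` is `r δ / 3`. -/
theorem descentExp_of_mem {N : ℕ} {r : ℕ → ℤ} {δ : ℕ} (h : δ ∈ N.divisors) : descentExp N r δ = r δ / 3 := by
  simp [descentExp, h]

/-- `descentExp` vanishes off the divisors of `N`. -/
theorem descentExp_of_not_mem {N : ℕ} {r : ℕ → ℤ} {δ : ℕ} (h : δ ∉ N.divisors) : descentExp N r δ = 0 := by
  simp [descentExp, h]

/-- The divisors of `N` are divisors of `3N`. -/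
theorem divisors_subset_divisors_three_mul {N : ℕ} (hN : N ≠ 0) : N.divisors ⊆ (3 * N).divisors :=
  Nat.divisors_subset_of_dvd (by positivity) (Dvd.intro_left 3 rfl)

/-- Sums over `(3N).divisors` of a quantity vanishing with the exponent restrict to `N.divisors`. -/
theorem sum_divisors_three_mul_descentExp {N : ℕ} (hN : N ≠ 0) (r : ℕ → ℤ) (F : ℕ → ℤ → ℤ)
    (hF : ∀ δ, F δ 0 = 0) :
    ∑ δ ∈ (3 * N).divisors, F δ (descentExp N r δ) = ∑ δ ∈ N.divisors, F δ (r δ / 3) := by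
  rw [← Finset.sum_subset (divisors_subset_divisors_three_mul hN)
    (fun δ _ hδ => by rw [descentExp_of_not_mem hδ, hF])]
  exact Finset.sum_congr rfl fun δ hδ => by rw [descentExp_of_mem hδ]

/-- **E-an-159 (PROVED).  Newman's weight-`0` conditions descend along `r ↦ r/3` to level `3N`** as soon as every
`r_δ ≡ 0 (mod 3)` and `72 ∣ Σ δ r_δ`: the second congruence at level `3N` is Newman's second congruence for `r` at
level `N` on the nose, and the square condition is inherited because `∏ δ^{|r_δ|} = (∏ δ^{|r_δ/3|})³`. [folklore] -/
theorem newmanCond_descentExp {N : ℕ} (hN : N ≠ 0) {r : ℕ → ℤ} (hr : NewmanCond N r 0)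
    (h3 : ∀ δ ∈ N.divisors, (3 : ℤ) ∣ r δ) (h72 : (72 : ℤ) ∣ ∑ δ ∈ N.divisors, (δ : ℤ) * r δ) :
    NewmanCond (3 * N) (descentExp N r) 0 := by
  refine ⟨?_, ?_, ?_, ?_⟩
  · rw [sum_divisors_three_mul_descentExp hN r (fun _ x => x) (fun _ => rfl)]
    have h0 := hr.sum_eq
    have : ∑ δ ∈ N.divisors, r δ = 3 * ∑ δ ∈ N.divisors, r δ / 3 := by
      rw [Finset.mul_sum]
      exact Finset.sum_congr rfl fun δ hδ => (Int.mul_ediv_cancel' (h3 δ hδ)).symm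
    omega
  · rw [sum_divisors_three_mul_descentExp hN r (fun δ x => (δ : ℤ) * x) (fun _ => mul_zero _)]
    have : ∑ δ ∈ N.divisors, (δ : ℤ) * r δ = 3 * ∑ δ ∈ N.divisors, (δ : ℤ) * (r δ / 3) := by
      rw [Finset.mul_sum]
      refine Finset.sum_congr rfl fun δ hδ => ?_
      rw [mul_left_comm, Int.mul_ediv_cancel' (h3 δ hδ)]
    omega
  · rw [sum_divisors_three_mul_descentExp hN r (fun δ x => ((3 * N / δ : ℕ) : ℤ) * x) (fun _ => mul_zero _)]
    have : ∑ δ ∈ N.divisors, ((3 * N / δ : ℕ) : ℤ) * (r δ / 3) = ∑ δ ∈ N.divisors, ((N / δ : ℕ) : ℤ) * r δ := by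
      refine Finset.sum_congr rfl fun δ hδ => ?_
      rw [Nat.mul_div_assoc 3 (Nat.dvd_of_mem_divisors hδ), Nat.cast_mul, Nat.cast_ofNat]
      linear_combination ((N / δ : ℕ) : ℤ) * Int.mul_ediv_cancel' (h3 δ hδ)
    rw [this]
    exact hr.sum_div_dvd
  · have hprod : ∏ δ ∈ (3 * N).divisors, δ ^ (descentExp N r δ).natAbs =
        ∏ δ ∈ N.divisors, δ ^ (r δ / 3).natAbs := by
      rw [← Finset.prod_subset (divisors_subset_divisors_three_mul hN)
        (fun δ _ hδ => by rw [descentExp_of_not_mem hδ]; simp)]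
      exact Finset.prod_congr rfl fun δ hδ => by rw [descentExp_of_mem hδ]
    rw [hprod]
    apply isSquare_of_isSquare_pow_three
    have hcube : (∏ δ ∈ N.divisors, δ ^ (r δ / 3).natAbs) ^ 3 = ∏ δ ∈ N.divisors, δ ^ (r δ).natAbs := by
      rw [← Finset.prod_pow]
      refine Finset.prod_congr rfl fun δ hδ => ?_
      rw [← pow_mul]
      congr 1
      obtain ⟨t, ht⟩ := h3 δ hδ
      rw [ht, Int.mul_ediv_cancel_left _ (by norm_num : (3 : ℤ) ≠ 0), Int.natAbs_mul]
      simp [mul_comm]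
    rw [hcube]
    exact hr.isSquare

/-! ### §2 The two descent nodes N1 / N2 and the closed composition `N1 → N2 → LAW₃` -/

/-- **N1 `CubeRepFirstDescent` (E-an-160; automorphic, theorem-grade, nothing asserted): every cuspidal Kummer cube
representative `Θ·B³·qⁿ¹ = qⁿ²·g·A³` of a series with `Θ(0) ≠ 0` has `72 ∣ S₁(r) = Σ δ r_δ`.**  Paper proof: `G₀ =
qⁿ²g/qⁿ¹ ∈ K_N` (a datum of the representative) and `η_r = q^{S₁/24} g ∈ K_N` (M1) give `q^{n₂−n₁−S₁/24} ∈ K_N`, so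
`n₂ − n₁ = S₁/24` (M2); `q`-orders in `ℚ⟦q⟧` give `3 ∣ n₂ − n₁`.  E-free; PROVED from M1 ∧ M2 in FILE B
(`cubeRepFirstDescent_of`).
[cite: Savitt2025, Thm. 1 (shape only: Newman's criterion, the tree's `etaQuotient_smul_of_mem_Gamma0`; the `72`-divisibility of cube representatives is the cell's N1, NOT in print — MEMO-an §79)] -/
@[conjecture]
def CubeRepFirstDescent : Prop :=
  ∀ {N : ℕ} [NeZero N] (Θ : ℚ⟦X⟧), constantCoeff Θ ≠ 0 →
    ∀ (r : ℕ → ℤ) (g A B : ℤ⟦X⟧), IsCuspidalKummerCubeRep N Θ r g A B →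
    (72 : ℤ) ∣ ∑ δ ∈ N.divisors, (δ : ℤ) * r δ

/-- **N2 `NoNewmanCubeRootRepAtThreeN` (E-an-161; geometric heart + bookkeeping, nothing asserted): for an
`X₀(N)`-optimal datum with `9 ∣ N` and a rational point of order `3` on the short model, NO cuspidal Kummer cube
representative of `Θ_T` has all `r_δ ≡ 0 (mod 3)` with `r/3` satisfying Newman's conditions at level `3N`.**  Paper
proof: `η_{r/3} ∈ K_{3N}` (M1), `η_{r/3}³ = η_r = G₀`, so `Θ_T = (η_{r/3}·A/B)³` is a cube in `K_{3N}` (M0) — against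
P79 (M2 fixes the exponent `n₂ − n₁ = S₁/24`).  PROVED from M0 ∧ M1 ∧ M2 ∧ P79 in FILE B (`noNewmanCubeRootRepAtThreeN_of`).
[cite: Stevens1989, Thm. 2.3 (shape only: optimal parametrisations and pull-back injectivity on Jacobians; the cube-root exclusion is the cell's N2, NOT in print — MEMO-an §79)] -/
@[conjecture]
def NoNewmanCubeRootRepAtThreeN : Prop :=
  ∀ (W : WeierstrassCurve ℚ) [W.IsElliptic] [W.IsGloballyMinimal] {N : ℕ} [NeZero N]
    (D : ModularParametrizationData W N) (a : ℕ → ℤ), (∀ n, (a n : ℂ) = cuspCoeff D.f n) →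
    9 ∣ N → (∀ z ∈ D.L.lattice, ∃ w ∈ periodLattice D.f, z = D.c * w) →
    ∀ X₀ Y₀ : ℚ, IsShortThreeTorsion W D.c X₀ Y₀ →
    ∀ z : ℚ⟦X⟧, IsParamGerm W D.c a z →
    ∀ (r : ℕ → ℤ) (g A B : ℤ⟦X⟧), (∀ δ ∈ N.divisors, (3 : ℤ) ∣ r δ) →
    NewmanCond (3 * N) (descentExp N r) 0 →
    ¬ IsCuspidalKummerCubeRep N (kummerCubeSeries W D.c X₀ Y₀ z) r g A B

/-- `f(g(X))(0) = f(0)` when `g(0) = 0` (local copy of the tree's folklore lemma, to keep this statement file free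
of `Theorems/` imports). [folklore] -/
private theorem constantCoeff_subst_of_constantCoeff_eq_zero' {R : Type*} [CommRing R] {g : R⟦X⟧}
    (hg : constantCoeff g = 0) (f : R⟦X⟧) : constantCoeff (f.subst g) = constantCoeff f := by
  rw [← coeff_zero_eq_constantCoeff_apply, coeff_subst' (HasSubst.of_constantCoeff_zero' hg),
    finsum_eq_single _ 0]
  · simp
  · intro d hd
    rw [coeff_zero_eq_constantCoeff_apply, map_pow, hg, zero_pow hd, smul_zero]

/-- `z³·y(z)` has constant term `−1` (local copy). [folklore] -/
private theorem constantCoeff_formalYMulCube'' {R : Type*} [CommRing R] (W : WeierstrassCurve R) :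
    constantCoeff W.formalYMulCube = -1 := by
  rw [formalYMulCube, map_neg, constantCoeff_invOfUnit, inv_one, Units.val_one]

/-- `Θ_T(0) = −1 ≠ 0` for a parametrisation germ (`IsParamGerm` gives `z(0) = 0`). [folklore] -/
theorem constantCoeff_kummerCubeSeries_ne_zero (W : WeierstrassCurve ℚ) (c : ℤ) (X₀ Y₀ : ℚ) {a : ℕ → ℤ}
    {z : ℚ⟦X⟧} (hz : IsParamGerm W c a z) : constantCoeff (kummerCubeSeries W c X₀ Y₀ z) ≠ 0 := by
  have hz0 : constantCoeff z = 0 := hz.1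
  have h : constantCoeff (kummerCubeSeries W c X₀ Y₀ z) = -1 := by
    rw [kummerCubeSeries, map_sub, map_sub, constantCoeff_subst_of_constantCoeff_eq_zero' hz0,
      constantCoeff_formalYMulCube'', smul_eq_C_mul, smul_eq_C_mul, smul_eq_C_mul, map_mul, map_pow, hz0,
      map_mul, map_sub, map_mul, map_mul, map_pow, hz0]
    simp
  rw [h]; norm_num

/-- **LAW₃ by descent (PROVED composition): N1 ∧ N2 ⟹ `CuspidalKummerCubeExponentLaw`.**  If every `r_δ` were
`≡ 0 (mod 3)`, N1 and E-an-159 put `r/3` under Newman's conditions at level `3N`, which N2 forbids. [folklore] -/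
theorem cuspidalKummerCubeExponentLaw_of_descent (h₁ : CubeRepFirstDescent) (h₂ : NoNewmanCubeRootRepAtThreeN) :
    CuspidalKummerCubeExponentLaw := by
  intro W _ _ N _ D a ha h9 hL X₀ Y₀ hT z hz r g A B hrep
  by_contra hcon
  push Not at hcon
  have h72 := h₁ (kummerCubeSeries W D.c X₀ Y₀ z) (constantCoeff_kummerCubeSeries_ne_zero W D.c X₀ Y₀ hz)
    r g A B hrep
  exact h₂ W D a ha h9 hL X₀ Y₀ hT z hz r g A B hcon (newmanCond_descentExp (NeZero.ne N) hrep.1 hcon h72) hrep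

/-- LAW₃♮ (C3 skeleton v18 stub `stub_cubeExponentLawNonBlind`) by descent, BY NAME. [folklore] -/
theorem cuspidalKummerCubeExponentLawNonBlind_of_descent (h₁ : CubeRepFirstDescent)
    (h₂ : NoNewmanCubeRootRepAtThreeN) : CuspidalKummerCubeExponentLawNonBlind :=
  cuspidalKummerCubeExponentLawNonBlind_of_law (cuspidalKummerCubeExponentLaw_of_descent h₁ h₂)

/-! ### §3 The four leaves M0, M1, M2 (automorphic) and P79 (geometric), typed -/

/-- The `ℂ`-Laurent series of an integer power series. -/
def toLaurent (p : ℤ⟦X⟧) : LaurentSeries ℂ := HahnSeries.ofPowerSeries ℤ ℂ (p.map (Int.castRingHom ℂ))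

/-- The positive part `∏_{δ ∣ M} E(q^δ)^{max(s_δ,0)}` of an `η`-quotient's unit series. -/
def etaPos (M : ℕ) (s : ℕ → ℤ) : ℤ⟦X⟧ := ∏ δ ∈ M.divisors, formalEulerScaled δ ^ (s δ).toNat

/-- The negative part `∏_{δ ∣ M} E(q^δ)^{max(−s_δ,0)}`. -/
def etaNeg (M : ℕ) (s : ℕ → ℤ) : ℤ⟦X⟧ := ∏ δ ∈ M.divisors, formalEulerScaled δ ^ (-(s δ)).toNat

/-- The `q`-expansion of `∏_{δ ∣ M} η(δτ)^{s_δ}` as a complex Laurent series: `q^{S₁(s)/24}·etaPos/etaNeg`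
(meaningful when `24 ∣ S₁(s) = Σ δ s_δ`). -/
def etaLaurent (M : ℕ) (s : ℕ → ℤ) : LaurentSeries ℂ :=
  HahnSeries.single ((∑ δ ∈ M.divisors, (δ : ℤ) * s δ) / 24) (1 : ℂ) *
    (toLaurent (etaPos M s) / toLaurent (etaNeg M s))

/-- **M0 `ModularFunctionFieldMono` (E-an-162; theorem-grade, nothing asserted): `K_M ≤ K_{M'}` for `M ∣ M'`**
(restriction of `Γ₀(M)`-forms to `Γ₀(M')`; `q`-expansions at `∞` unchanged). [folklore] -/
def ModularFunctionFieldMono : Prop :=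
  ∀ (M M' : ℕ) [NeZero M'], M ∣ M' → modularFunctionField M ≤ modularFunctionField M'

/-- **M1 `EtaQuotientMemFunctionField` (E-an-163; theorem-grade, nothing asserted): under Newman's weight-`0`
conditions the `q`-expansion of `∏ η(δτ)^{s_δ}` lies in `K_M`** (`η_s = F/G` with `G = ∏_δ Δ(δτ)^m`, `F = η_s·G` an
`η`-PRODUCT with non-negative exponents, both in `M_{12mσ₀(M)}(Γ₀(M))` by the tree's `etaQuotient_smul_of_mem_Gamma0`).
[cite: Savitt2025, Thm. 1 (shape only: Newman's criterion as landed in the tree; membership in the tree's `modularFunctionField` is the cell's M1 packaging, theorem-grade)] -/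
def EtaQuotientMemFunctionField : Prop :=
  ∀ (M : ℕ) [NeZero M] (s : ℕ → ℤ), NewmanCond M s 0 → etaLaurent M s ∈ modularFunctionField M

/-- **M2 `MonomialNotModularFunction` (E-an-164; theorem-grade, nothing asserted): a pure power `q^m` is the
`q`-expansion of a modular function for `Γ₀(M)` only if `m = 0`** (`F = q^m G` on `ℍ` and `γ = (1 0; M 1)` give
`m(γτ − τ) ∈ ℤ` for all `τ`). [folklore] -/
def MonomialNotModularFunction : Prop :=
  ∀ (M : ℕ) [NeZero M] (m : ℤ), HahnSeries.single m (1 : ℂ) ∈ modularFunctionField M → m = 0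

/-- **P79 `KummerCubeSeriesNotCubeAtThreeN` (E-an-165; the geometric heart, nothing asserted): for an `X₀(N)`-optimal
datum with `9 ∣ N` and a rational point `T` of order `3` on the short model, `Θ_T` is not a cube in `K_{3N}`.**  Paper
proof: `Θ_T = (t³ f_T)∘φ`, `div f_T = 3(T) − 3(O)`; a cube root in `ℂ(X₀(3N))` makes `π^*φ^*((T) − (O))` principal;
`π : X₀(3N) → X₀(N)` is totally ramified at the cusp `0` (so `π^*` is injective on Jacobians) and `φ^*` is injective by
optimality (lattice clause); `T ≠ O`.  Dictionary: «formal germ = parametrisation» (`IsParamGerm`, as for E-an-47/55/57).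
Why it might fail: only through the dictionary (a germ `z` satisfying `IsParamGerm` that is not the expansion of `φ` —
excluded by uniqueness of the formal logarithm).
[cite: Stevens1989, Thm. 2.3 (shape only: optimal quotients / étale isogenies; the statement P79 is the cell's, NOT in print — MEMO-an §79)] -/
@[conjecture]
def KummerCubeSeriesNotCubeAtThreeN : Prop :=
  ∀ (W : WeierstrassCurve ℚ) [W.IsElliptic] [W.IsGloballyMinimal] {N : ℕ} [NeZero N]
    (D : ModularParametrizationData W N) (a : ℕ → ℤ), (∀ n, (a n : ℂ) = cuspCoeff D.f n) →
    9 ∣ N → (∀ z ∈ D.L.lattice, ∃ w ∈ periodLattice D.f, z = D.c * w) →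
    ∀ X₀ Y₀ : ℚ, IsShortThreeTorsion W D.c X₀ Y₀ →
    ∀ z : ℚ⟦X⟧, IsParamGerm W D.c a z →
    ∀ u ∈ modularFunctionField (3 * N),
      HahnSeries.ofPowerSeries ℤ ℂ ((kummerCubeSeries W D.c X₀ Y₀ z).map (algebraMap ℚ ℂ)) ≠ u ^ 3

end Summit.BirchSwinnertonDyer.Rank1Residual.ManinAdditive.CuspidalKummerThree
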